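import Summits.QuantumFields.BalabanUV.T4Continuum.Support.VariationalCovariantTwoRunsTransport
import Summits.QuantumFields.BalabanUV.T4Continuum.Support.VariationalCovariantTwoRunsNE3
import Summits.QuantumFields.BalabanUV.T4Continuum.Support.VariationalCovariantTwoRunsEnd

/-!
# T⁴ programme, spine node NE2 (U1a), lane P2 — SUPPLIER ITEM (O2′) «THE NE3 ADAPTER RE-TARGETED INTO THE RAW-DISTANCE SOCKET», file 2 of 2:
# node U1b's `LocalRate` ⟹ the TWO-RUN CLASS (`n·ρ_k ≤ c_ρ·θ′^k` raw bond distance, `τ_k ≤ d·c_ρ·θ′^k` nested site transports) of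
# `VariationalCovariantTwoRunsEnd.towerLimitRate_twoRuns_closed`, and THE END WITH THE TWO-RUN CLASS DISCHARGED FROM `LocalRate`

NE2 formalisation swarm `b2b-balaban-t4-ne2-formalise-*`, leaf prover 09 (gen 5); register row «P2-sup» of `t4/formal/NE2/LEAVES.md`; the
road owner `b2b-balaban-t4-ne2-p2` gen 11 (journal CLAIMS.log l.11188 (2) «the adapter's job is now `LocalRate` ⟹ (`n·ρ_k ≤ c_ρ θ^k` for the RAW
bond-phase distance in a common gauge) ∧ (`τ_k ≤ c_τ θ^k` for the nested site transports, … by telescoping along contours)», l.11313 (iii);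
skeleton `t4/skeletons/NE2-t4-ne2-p2.md` v0.12 §0 R).  Inputs BY NAME: file 1 `VariationalCovariantTwoRunsTransport` (`nestOf`, `norm_nestOf`,
`nestOf_succ_tower`, `norm_nestOf_sub_nestOf_le`), leaf-09-g4's `VariationalCovariantTwoRuns` (`towReadings`, `coarsen`) ∕ `VariationalCovariantTwoRunsNE3`
(`fineOf`, `Rtr_fineOf`, `lev_mul_norm_coarsen_sub_le_of_localRate_max`), the road owner's `VariationalCovariantTwoRunsEnd`
(`towerLimitRate_twoRuns_closed`, `cTwoRuns`), leaf-04-g2's `VariationalTaxiTransport.taxiT` ∕ `VariationalTaxiCoarse.coarseT`, node U1b's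
`T4EtaRateMin.LocalRate`.
THE OBJECTS.  A tower `Rc : (k : ℕ) → Tor (fine (L^k) M) → Fin d → ℂ` of unit bond phases — run `k`'s background at its own level `k`, member of a
class `𝒟` on which node U1b's `LocalRate (towReadings L M 𝒟) C θ` is DISPLAYED (not discharged) — with the size class `‖L^k·(Rc k − 1)‖ ≤ α`.
Run `k+1` presented over level `k` is `R′ k := fineOf L M Rc k`; its COARSE PARTNER is the straight `L`-bond coarsening
`Rb k := coarseT L (fine (L^k) M) (R′ k)` (= leaf-09-g4's `coarsen`, `rfl`); the site transports are THE SAME CONTOUR SYSTEM on both runs: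
`T k := nestOf L M k (Rc k)`, `Tb k := nestOf L M k (Rb k)` (file 1), the one-step transport `T′ k := taxiT L (fine (L^k) M) (R′ k)`.
 * §1 the two-run constants: `cRho C α := 2C + (α²∕2)e^α`, `rho L C θ α k := cRho·(max θ L⁻¹)^k ∕ L^k`, `tau d L C θ α k := d·(L^k − 1)·rho k`;
   `lev_mul_rho`, `rho_nonneg`, `tau_nonneg`, `tau_le` (`τ_k ≤ d·cRho·(max θ L⁻¹)^k`);
 * §2 THE SOCKET's SIX BINDERS DISCHARGED: **`norm_coarse_sub_le_of_localRate`** (`hρ`: `‖Rb k y μ − Rc k y μ‖ ≤ ρ_k`, from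
   `lev_mul_norm_coarsen_sub_le_of_localRate_max`), `hρc` = `lev_mul_rho`, **`norm_nest_sub_nest_le_of_localRate`** (`hτ`:
   `‖Tb k x − T k x‖ ≤ τ_k`, file 1's telescoping), `hτc` = `tau_le`;
 * §3 **`towerLimitRate_twoRuns_of_localRate`** — THE TWO-RUNS END WITH ITS TWO-RUN CLASS DISCHARGED FROM NODE U1b's `LocalRate`:
   `towerLimitRate_twoRuns_closed` (p215328) for data `(Rc, Rb, T, Tb, R′, T′)` GIVEN BY THE FIVE PRESENTATION EQUATIONS above (hypotheses
   `hR′ hRb hT hTb hT′`, inhabited by `fun _ => rfl`), with `hT∕hTb∕hRb1∕hR'∕hT'1` from unit phases, `hTcomp` = file 1's `nestOf_succ_tower`,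
   `hRtr` = `Rtr_fineOf`, and `hθ0 hθ1 hρ0 hρ hρc hτ0 hτ hτc` from §§1–2; EVERY OTHER binder of p215328 (run-`k` UB⁺∕P⁺ in leaf shape, the two P⁺
   frame families, `hmis∕habsorb`, the reference transports `Tb₀` with `hwin∕hrel∕hw′`, `hP`, `hin∕hcross`, the pair's CLASS) DISPLAYED VERBATIM;
   conclusion `TowerLimitRate (fun _ ↦ 1) 1 (fun k => effSc (L^k) M (Rc k) (T k) a₀) (cTwoRuns d L c_w′ c_a c_m c₁ cRho (d·cRho)) (max θ L⁻¹)`.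
WHAT IS NOT HERE (stated, not hidden): any discharge of `LocalRate` (node NE3 ∕ U1b OPEN — DISPLAYED); the displayed binders at taxi data ((O7)
`VariationalTaxiTowerEnd` pattern through file 1's bridge `nestT_succ_eq_nestOf`, (O10) `tower_hrel`; the frame-free `…Local` twins are the
owner's (O12)); any identification of `𝒟` with Bałaban's minimisers `U_k(V)` (no B0, trigger c5).  The version on node NE3's own carrier
`MinimalActionRate.minActReadings` (leaf-09-g4's `Spine/NE2VariationalTwoRunsFromNE3.p2Loc`) is the Spine companion `NE2VariationalTwoRunsEndFromNE3`.

HONEST FRAMING (T4-DAG p. 1).  Model level (U(1) charged-scalar sector of road P2; phases ∕ taxi contours ∕ frames ∕ defects = DATA;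
[Balaban1985BackgroundPropagators] (3.15) ∕ (3.19) p.393 SHAPES only); bookkeeping + file 1's elementary telescoping, [folklore]; nothing printed
is a hypothesis; no `def … : Prop`; no `sorry`; axioms standard.  NE3 OPEN (its `LocalRate` is a displayed hypothesis); NE2 NOT proved; spine
PROVED 0∕9 unchanged; rung (B)+1 finite T⁴ — NOT infinite volume, NOT a mass gap, NOT Clay.  HONEST DEPENDENCY (cell, verbatim): continuum YM
on T⁴ ⇐ BetaPertH ∧ nine spine estimates (0/9 proved); BetaPertH ⇐ (D1) ∧ (D4) ∧ CAP+tail; G-an2-4 gates asym, D1 and NE2/3/4.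
-/

noncomputable section

open scoped Matrix ComplexConjugate ComplexOrder Matrix.Norms.L2Operator BigOperators

namespace Summit.QuantumFields.BalabanUV.T4Continuum.VariationalCovariantTwoRunsSocket

open Literature.MathematicalPhysics.QuantumFieldTheory.Balaban1983to89.B5Prop11Plancherel (Tor fine unitVec)
open Literature.MathematicalPhysics.QuantumFieldTheory.Balaban1983to89.B5Prop11Lower (nsq)
open Literature.MathematicalPhysics.QuantumFieldTheory.Balaban1983to89.B5Block118 (bpt)
open Literature.MathematicalPhysics.QuantumFieldTheory.Balaban1983to89.T4EtaRateMin (LocalRate)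
open Summit.QuantumFields.BalabanUV.T4Continuum.VariationalCovariantEffective (effSc)
open Summit.QuantumFields.BalabanUV.T4Continuum.VariationalCovariantTower (compT Rtr)
open Summit.QuantumFields.BalabanUV.T4Continuum.VariationalCovariantFederbush (mis)
open Summit.QuantumFields.BalabanUV.T4Continuum.VariationalCovariantScalarPair (Sc qW Qk)
open Summit.QuantumFields.BalabanUV.T4Continuum.VariationalCovariantEnd (lamC)
open Summit.QuantumFields.BalabanUV.T4Continuum.VariationalCovariantTwoRuns (towReadings coarsen)
open Summit.QuantumFields.BalabanUV.T4Continuum.VariationalCovariantTwoRunsNE3 (fineOf Rtr_fineOf lev_mul_norm_coarsen_sub_le_of_localRate_max)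
open Summit.QuantumFields.BalabanUV.T4Continuum.VariationalCovariantTwoRunsEnd (cTwoRuns towerLimitRate_twoRuns_closed)
open Summit.QuantumFields.BalabanUV.T4Continuum.VariationalCovariantTwoRunsTransport (nestOf norm_nestOf nestOf_succ_tower norm_nestOf_sub_nestOf_le)
open Summit.QuantumFields.BalabanUV.T4Continuum.CovariantAveragingTower (TowerLimitRate)
open Summit.QuantumFields.BalabanUV.T4Continuum.VariationalTaxiTransport (taxiT norm_taxiT)
open Summit.QuantumFields.BalabanUV.T4Continuum.VariationalTaxiCoarse (coarseT norm_coarseT)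

variable {d : ℕ} (L : ℕ) [NeZero L] (M : Fin d → ℕ) [hM : ∀ μ, NeZero (M μ)]

/-! ## §1 The two-run constants -/

/-- the k-UNIFORM bond constant of the two-run class: `c_ρ = 2C + (α²∕2)e^α` (`C` node U1b's rate constant, `α` the size class). [folklore] -/
def cRho (C α : ℝ) : ℝ := 2 * C + α ^ 2 / 2 * Real.exp α

/-- the raw bond distance at level `k`: `ρ_k = c_ρ·(max θ L⁻¹)^k ∕ L^k`. [folklore] -/
def rho (C θ α : ℝ) (k : ℕ) : ℝ := cRho C α * (max θ (L : ℝ)⁻¹) ^ k / (((L ^ k : ℕ)) : ℝ)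

/-- the site-transport distance at level `k`: `τ_k = d·(L^k − 1)·ρ_k` (file 1's nested-contour length `d(L^k − 1)`). [folklore] -/
def tau (d L : ℕ) (C θ α : ℝ) (k : ℕ) : ℝ := (d : ℝ) * ((L : ℝ) ^ k - 1) * rho L C θ α k

omit [NeZero L] in
/-- `0 ≤ c_ρ` for `0 ≤ C`. [folklore] -/
theorem cRho_nonneg {C : ℝ} (hC : 0 ≤ C) (α : ℝ) : 0 ≤ cRho C α := by unfold cRho; positivity

/-- `L^k·ρ_k = c_ρ·(max θ L⁻¹)^k` — the socket's `hρc` with equality. [folklore] -/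
theorem lev_mul_rho (C θ α : ℝ) (k : ℕ) : (((L ^ k : ℕ)) : ℝ) * rho L C θ α k = cRho C α * (max θ (L : ℝ)⁻¹) ^ k := by
  have hn0 : (((L ^ k : ℕ)) : ℝ) ≠ 0 := by push_cast; exact pow_ne_zero k (Nat.cast_ne_zero.mpr (NeZero.ne L))
  rw [rho, mul_div_cancel₀ _ hn0]

omit [NeZero L] in
/-- `0 ≤ ρ_k` (`0 ≤ C`, `0 ≤ θ`). [folklore] -/
theorem rho_nonneg {C θ : ℝ} (hC : 0 ≤ C) (hθ : 0 ≤ θ) (α : ℝ) (k : ℕ) : 0 ≤ rho L C θ α k := by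
  unfold rho
  have : (0 : ℝ) ≤ (max θ (L : ℝ)⁻¹) ^ k := pow_nonneg (le_max_of_le_left hθ) k
  have := cRho_nonneg hC α
  positivity

/-- `0 ≤ τ_k`. [folklore] -/
theorem tau_nonneg {C θ : ℝ} (hC : 0 ≤ C) (hθ : 0 ≤ θ) (α : ℝ) (k : ℕ) : 0 ≤ tau d L C θ α k := by
  have hL1 : (1 : ℝ) ≤ L := Nat.one_le_cast.mpr (Nat.one_le_iff_ne_zero.mpr (NeZero.ne L))
  have h1 : (0 : ℝ) ≤ (L : ℝ) ^ k - 1 := sub_nonneg.mpr (one_le_pow₀ hL1)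
  unfold tau
  exact mul_nonneg (mul_nonneg (Nat.cast_nonneg d) h1) (rho_nonneg L hC hθ α k)

/-- **the socket's `hτc`**: `τ_k ≤ d·c_ρ·(max θ L⁻¹)^k` (`d(L^k − 1)·ρ_k ≤ d·L^k·ρ_k`). [folklore] -/
theorem tau_le {C θ : ℝ} (hC : 0 ≤ C) (hθ : 0 ≤ θ) (α : ℝ) (k : ℕ) :
    tau d L C θ α k ≤ (d : ℝ) * cRho C α * (max θ (L : ℝ)⁻¹) ^ k := by
  have hρ := rho_nonneg L hC hθ α k
  have e : (d : ℝ) * cRho C α * (max θ (L : ℝ)⁻¹) ^ k = (d : ℝ) * (L : ℝ) ^ k * rho L C θ α k := by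
    rw [mul_assoc (d : ℝ) ((L : ℝ) ^ k), ← Nat.cast_pow, lev_mul_rho, mul_assoc]
  rw [e, tau]
  have : (0 : ℝ) ≤ (d : ℝ) * rho L C θ α k := mul_nonneg (Nat.cast_nonneg d) hρ
  nlinarith

/-! ## §2 The socket's distance binders from node U1b's `LocalRate` -/

section Binders

variable {𝒟 : Set ((k : ℕ) → Tor (fine (L ^ k) M) → Fin d → ℂ)} {C θ α : ℝ}
variable {Rc : (k : ℕ) → Tor (fine (L ^ k) M) → Fin d → ℂ}

/-- **THE RAW BOND DISTANCE (`hρ`) FROM `LocalRate`**: `‖coarseT (fineOf Rc k) (y,μ) − Rc k y μ‖ ≤ ρ_k` for every tower of the class with the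
size class — leaf-09-g4's `lev_mul_norm_coarsen_sub_le_of_localRate_max` (`coarsen = coarseT`, `rfl`) divided by `L^k`. [folklore] -/
theorem norm_coarse_sub_le_of_localRate (hC : 0 ≤ C) (hθ : 0 ≤ θ) (hα : 0 ≤ α) (h : LocalRate (towReadings L M 𝒟) C θ) (hR : Rc ∈ 𝒟)
    (hsize : ∀ k x μ, ‖((L ^ k : ℕ) : ℂ) * (Rc k x μ - 1)‖ ≤ α) (k : ℕ) (y : Tor (fine (L ^ k) M)) (μ : Fin d) :
    ‖coarseT L (fine (L ^ k) M) (fineOf L M Rc k) y μ - Rc k y μ‖ ≤ rho L C θ α k := by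
  have hn0 : (0 : ℝ) < (((L ^ k : ℕ)) : ℝ) := by
    push_cast; exact pow_pos (Nat.cast_pos.mpr (Nat.pos_of_ne_zero (NeZero.ne L))) k
  have h1 := lev_mul_norm_coarsen_sub_le_of_localRate_max L M hC hθ hα h hR hsize k y μ
  rw [rho, cRho, le_div_iff₀ hn0, mul_comm]
  exact h1

/-- **THE SITE-TRANSPORT DISTANCE (`hτ`) FROM `LocalRate`**: the nested taxi transports of the coarse partner and of run `k` are `τ_k`-close,
`‖nestOf k (coarseT (fineOf Rc k)) x − nestOf k (Rc k) x‖ ≤ τ_k = d·(L^k − 1)·ρ_k` (file 1's contour telescoping on `hρ`). [folklore] -/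
theorem norm_nest_sub_nest_le_of_localRate (hC : 0 ≤ C) (hθ : 0 ≤ θ) (hα : 0 ≤ α) (h : LocalRate (towReadings L M 𝒟) C θ) (hR : Rc ∈ 𝒟)
    (hRc1 : ∀ k x μ, ‖Rc k x μ‖ = 1) (hsize : ∀ k x μ, ‖((L ^ k : ℕ) : ℂ) * (Rc k x μ - 1)‖ ≤ α) (k : ℕ) (x : Tor (fine (L ^ k) M)) :
    ‖nestOf L M k (coarseT L (fine (L ^ k) M) (fineOf L M Rc k)) x - nestOf L M k (Rc k) x‖ ≤ tau d L C θ α k := by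
  have hRb1 : ∀ y μ, ‖coarseT L (fine (L ^ k) M) (fineOf L M Rc k) y μ‖ = 1 :=
    norm_coarseT L (fine (L ^ k) M) (fun x' μ => hRc1 (k + 1) _ μ)
  unfold tau
  exact norm_nestOf_sub_nestOf_le L M k hRb1 (hRc1 k) (rho_nonneg L hC hθ α k)
    (norm_coarse_sub_le_of_localRate L M hC hθ hα h hR hsize k) x

end Binders

/-! ## §3 The two-runs END with its two-run class discharged from node U1b's `LocalRate` -/

section End

variable (Rc Rb : (k : ℕ) → Tor (fine (L ^ k) M) → Fin d → ℂ) (T Tb Tb₀ : (k : ℕ) → Tor (fine (L ^ k) M) → ℂ)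
variable (R' : (k : ℕ) → Tor (fine L (fine (L ^ k) M)) → Fin d → ℂ) (T' : (k : ℕ) → Tor (fine L (fine (L ^ k) M)) → ℂ)
variable (G : (k : ℕ) → Tor (fine (L ^ k) M) → ℂ) (c : (k : ℕ) → Tor M → ℂ) (mG mB : ℕ → ℝ)
variable (G' : (k : ℕ) → Tor (fine L (fine (L ^ k) M)) → ℂ) (c' : (k : ℕ) → Tor (fine (L ^ k) M) → ℂ) (mG' mB' : ℕ → ℝ)
variable (m w w' a m₁ : ℕ → ℝ)

/-- **THE TWO-RUNS END WITH THE TWO-RUN CLASS DISCHARGED FROM NODE U1b's `LocalRate` (P2, scalar covariant species, model level).**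
The road owner's `towerLimitRate_twoRuns_closed` (p215328) for a tower of runs `Rc ∈ 𝒟` (unit phases, size class `α`) on whose class node U1b's
`LocalRate (towReadings L M 𝒟) C θ` holds (DISPLAYED), the two runs' objects being THE CONTOUR SYSTEM APPLIED TO THEIR OWN PHASES:
`R′ k = fineOf Rc k`, `Rb k = coarseT (R′ k)`, `T k = nestOf k (Rc k)`, `Tb k = nestOf k (Rb k)`, `T′ k = taxiT (R′ k)` (five presentation
equations, `rfl` for the canonical choice).  DISCHARGED here: unit modulus of `T∕Tb∕Rb∕R′∕T′`, COMP⁺ (`nestOf_succ_tower`), `hRtr` (`Rtr_fineOf`),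
and the TWO-RUN CLASS `‖Rb k − Rc k‖ ≤ ρ_k`, `L^k·ρ_k ≤ c_ρ·θ′^k`, `‖Tb k − T k‖ ≤ τ_k ≤ d·c_ρ·θ′^k`, `θ′ = max θ L⁻¹ < 1`, `c_ρ = 2C + (α²∕2)e^α`.
DISPLAYED VERBATIM (p215328's letters): run-`k` UB⁺∕P⁺ in leaf shape, both P⁺ frame families, the mismatch `m` with its absorption, the
reference transports `Tb₀` (`hwin`, `hrel ≤ γ < 1`, `hw′`), the plaquette defect `a`, the one-step defects `m₁` (`hin`, `hcross`), the pair's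
CLASS.  THEN `TowerLimitRate (fun _ ↦ 1) 1 (fun k => effSc (L^k) M (Rc k) (T k) a₀) (cTwoRuns d L c_w′ c_a c_m c₁ c_ρ (d·c_ρ)) (max θ L⁻¹)`.
NE3 NOT discharged; NE2 NOT proved. [folklore] -/
theorem towerLimitRate_twoRuns_of_localRate (hL : 2 ≤ L)
    -- node U1b's local half on the class, the tower of runs, its size class
    {𝒟 : Set ((k : ℕ) → Tor (fine (L ^ k) M) → Fin d → ℂ)} {C θ α : ℝ} (hC : 0 ≤ C) (hθ0 : 0 ≤ θ) (hθ1 : θ < 1) (hα : 0 ≤ α)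
    (hNE3 : LocalRate (towReadings L M 𝒟) C θ) (hRc𝒟 : Rc ∈ 𝒟)
    (hRc1 : ∀ k x μ, ‖Rc k x μ‖ = 1) (hsize : ∀ k x μ, ‖((L ^ k : ℕ) : ℂ) * (Rc k x μ - 1)‖ ≤ α)
    -- the five presentation equations
    (hR'def : ∀ k, R' k = fineOf L M Rc k) (hRbdef : ∀ k, Rb k = coarseT L (fine (L ^ k) M) (R' k))
    (hTdef : ∀ k, T k = nestOf L M k (Rc k)) (hTbdef : ∀ k, Tb k = nestOf L M k (Rb k))
    (hT'def : ∀ k, T' k = taxiT L (fine (L ^ k) M) (R' k))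
    -- run-k data: leaf UB⁺ and P⁺ in leaf shape (displayed)
    (hUBk : ∀ k (μ : Tor M → ℂ), ∃ f, Qk (L ^ k) M (T k) f = μ ∧
      Sc (L ^ k) M (Rc k) f ≤ lamC d ((((L ^ k : ℕ)) : ℝ) * w' k) * nsq μ)
    (hPk : ∀ k f, qW (L ^ k) M f ≤ (1088 * (d : ℝ) + 128) * (Sc (L ^ k) M (Rc k) f + nsq (Qk (L ^ k) M (T k) f)))
    -- P⁺ frames of the coarse partner and of the pair (displayed)
    (hG : ∀ k x, ‖G k x‖ = 1) (hc : ∀ k z, ‖c k z‖ ≤ 1)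
    (hframe : ∀ k x μ, ‖G k (x + unitVec (fine (L ^ k) M) μ) - G k x * Rb k x μ‖ ≤ mG k)
    (hblock : ∀ k z j, ‖G k (bpt (L ^ k) M z j) - c k z * Tb k (bpt (L ^ k) M z j)‖ ≤ mB k)
    (hsmall : ∀ k, 16 * (d : ℝ) ^ 2 * ((((L ^ k : ℕ)) : ℝ) * mG k) ^ 2 + 4 * mB k ^ 2 ≤ 1 / 2)
    (hG' : ∀ k x, ‖G' k x‖ = 1) (hc' : ∀ k y, ‖c' k y‖ ≤ 1)
    (hframe' : ∀ k x μ, ‖G' k (x + unitVec (fine L (fine (L ^ k) M)) μ) - G' k x * R' k x μ‖ ≤ mG' k)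
    (hblock' : ∀ k y j, ‖G' k (bpt L (fine (L ^ k) M) y j) - c' k y * T' k (bpt L (fine (L ^ k) M) y j)‖ ≤ mB' k)
    (hsmall' : ∀ k, 16 * (d : ℝ) ^ 2 * ((L : ℝ) * mG' k) ^ 2 + 4 * mB' k ^ 2 ≤ 1 / 2)
    -- the pair's mismatch and its absorption (displayed)
    (hm : ∀ k, 0 ≤ m k) (hmis : ∀ k y μ j, ‖mis L (fine (L ^ k) M) (Rb k) (R' k) (T' k) y μ j‖ ≤ m k)
    (habsorb : ∀ k, 512 * (d : ℝ) ^ 2 * ((((L ^ k : ℕ)) : ℝ) * m k) ^ 2 ≤ 1 / 2)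
    -- the reference transports of the relative UB⁺ (displayed)
    (hTb₀ : ∀ k x, ‖Tb₀ k x‖ = 1) (hw : ∀ k, 0 ≤ w k)
    (hwin : ∀ k (y : Tor M) (j : Fin d → Fin (L ^ k)) (μ : Fin d), (j μ : ℕ) + 1 < L ^ k →
      ‖Rb k (bpt (L ^ k) M y j) μ * (starRingEnd ℂ) (Tb₀ k (bpt (L ^ k) M y j + unitVec (fine (L ^ k) M) μ)) * Tb₀ k (bpt (L ^ k) M y j) - 1‖
        ≤ w k)
    {γ : ℝ} (hγ : γ < 1) (hrel : ∀ k x, ‖Tb k x * (starRingEnd ℂ) (Tb₀ k x) - 1‖ ≤ γ)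
    (hw'0 : ∀ k, 0 ≤ w' k) (hw' : ∀ k, (4 + (((L ^ k : ℕ)) : ℝ) * w k) / (1 - γ) - 1 ≤ (((L ^ k : ℕ)) : ℝ) * w' k)
    -- plaquette and one-step defects (displayed)
    (ha : ∀ k, 0 ≤ a k)
    (hP : ∀ k x μ ν, ‖Rb k x μ * Rb k (x + unitVec (fine (L ^ k) M) μ) ν - Rb k x ν * Rb k (x + unitVec (fine (L ^ k) M) ν) μ‖ ≤ a k)
    (hm₁ : ∀ k, 0 ≤ m₁ k)
    (hin : ∀ k (y : Tor (fine (L ^ k) M)) (j : Fin d → Fin L) (μ : Fin d), (j μ : ℕ) + 1 < L →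
      ‖R' k (bpt L (fine (L ^ k) M) y j) μ * (starRingEnd ℂ) (T' k (bpt L (fine (L ^ k) M) y j + unitVec (fine L (fine (L ^ k) M)) μ))
          * T' k (bpt L (fine (L ^ k) M) y j) - 1‖ ≤ m₁ k)
    (hcross : ∀ k (y : Tor (fine (L ^ k) M)) (j : Fin d → Fin L) (μ : Fin d), (j μ : ℕ) + 1 = L →
      ‖R' k (bpt L (fine (L ^ k) M) y j) μ * (starRingEnd ℂ) (T' k (bpt L (fine (L ^ k) M) y j + unitVec (fine L (fine (L ^ k) M)) μ))
          * T' k (bpt L (fine (L ^ k) M) y j) - Rb k y μ‖ ≤ m₁ k)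
    -- the pair's CLASS (displayed)
    {cw ca cm c₁ : ℝ}
    (hwc : ∀ k, (((L ^ k : ℕ)) : ℝ) * w' k ≤ cw) (hac : ∀ k, a k * (((L ^ k : ℕ)) : ℝ) ^ 2 ≤ ca)
    (hmc : ∀ k, (((L ^ k : ℕ)) : ℝ) ^ 2 * m k ≤ cm) (hm₁c : ∀ k, (((L ^ k : ℕ)) : ℝ) ^ 2 * m₁ k ≤ c₁)
    -- the mass
    {a₀ : ℝ} (ha₀ : 0 < a₀) :
    TowerLimitRate (ι := fun _ => Tor M) (fun _ => (1 : Matrix (Tor M) (Tor M) ℂ)) 1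
      (fun k => effSc (L ^ k) M (Rc k) (T k) a₀) (cTwoRuns d L cw ca cm c₁ (cRho C α) ((d : ℝ) * cRho C α)) (max θ (L : ℝ)⁻¹) := by
  have hL2 : (2 : ℝ) ≤ L := by exact_mod_cast hL
  have hLinv1 : (L : ℝ)⁻¹ < 1 := inv_lt_one_of_one_lt₀ (by linarith)
  have hθ'0 : 0 ≤ max θ (L : ℝ)⁻¹ := le_max_of_le_left hθ0
  have hθ'1 : max θ (L : ℝ)⁻¹ < 1 := max_lt hθ1 hLinv1
  -- unit modulus of the presented objects
  have hR'1 : ∀ k x μ, ‖R' k x μ‖ = 1 := fun k x μ => by rw [hR'def k]; exact hRc1 (k + 1) _ μ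
  have hRb1 : ∀ k y μ, ‖Rb k y μ‖ = 1 := fun k y μ => by rw [hRbdef k]; exact norm_coarseT L (fine (L ^ k) M) (hR'1 k) y μ
  have hT1 : ∀ k x, ‖T k x‖ = 1 := fun k x => by rw [hTdef k]; exact norm_nestOf L M k (hRc1 k) x
  have hTb1 : ∀ k x, ‖Tb k x‖ = 1 := fun k x => by rw [hTbdef k]; exact norm_nestOf L M k (hRb1 k) x
  have hT'1 : ∀ k x, ‖T' k x‖ = 1 := fun k x => by rw [hT'def k]; exact norm_taxiT L (fine (L ^ k) M) (hR'1 k) x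
  -- COMP⁺ and `hRtr` by construction
  have hTcomp : ∀ k, T (k + 1) = compT (L ^ k) L M (Tb k) (T' k) := fun k => by
    rw [hTdef (k + 1), hTbdef k, hT'def k, hRbdef k, hR'def k]
    exact nestOf_succ_tower L M Rc k
  have hRtr : ∀ k, Rc (k + 1) = Rtr (L ^ k) L M (R' k) := fun k => by rw [hR'def k, Rtr_fineOf]
  -- the two-run class from `LocalRate`
  have hρ : ∀ k y μ, ‖Rb k y μ - Rc k y μ‖ ≤ rho L C θ α k := fun k y μ => by
    rw [hRbdef k, hR'def k]; exact norm_coarse_sub_le_of_localRate L M hC hθ0 hα hNE3 hRc𝒟 hsize k y μ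
  have hτ : ∀ k x, ‖Tb k x - T k x‖ ≤ tau d L C θ α k := fun k x => by
    rw [hTbdef k, hTdef k, hRbdef k, hR'def k]
    exact norm_nest_sub_nest_le_of_localRate L M hC hθ0 hα hNE3 hRc𝒟 hRc1 hsize k x
  have key := towerLimitRate_twoRuns_closed L M Rc Rb T Tb Tb₀ R' T' G c mG mB G' c' mG' mB' m w w' a m₁
    (rho L C θ α) (tau d L C θ α) hL hT1 hUBk hPk hTb1 hRb1 (fun k x μ => (hR'1 k x μ).le) hT'1 hTcomp hRtr
    hG hc hframe hblock hsmall hG' hc' hframe' hblock' hsmall' hm hmis habsorb hTb₀ hw hwin hγ hrel hw'0 hw' ha hP hm₁ hin hcross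
    hwc hac hmc hm₁c hθ'0 hθ'1 (rho_nonneg L hC hθ0 α) hρ (fun k => (lev_mul_rho L C θ α k).le)
    (tau_nonneg (d := d) L hC hθ0 α) hτ (fun k => tau_le (d := d) L hC hθ0 α k) ha₀
  have e : max ((L : ℝ)⁻¹) (max θ (L : ℝ)⁻¹) = max θ (L : ℝ)⁻¹ := by
    rw [← max_assoc, max_comm ((L : ℝ)⁻¹) θ, max_assoc, max_self]
  rw [e] at key
  exact key

/-- **THE CANONICAL INSTANCE** (the five presentation equations by `rfl`): the same END stated directly on
`(Rc, coarseT (fineOf Rc ·), nestOf · (Rc ·), nestOf · (coarseT (fineOf Rc ·)), fineOf Rc, taxiT (fineOf Rc ·))`. [folklore] -/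
theorem towerLimitRate_twoRuns_of_localRate_nest (hL : 2 ≤ L)
    {𝒟 : Set ((k : ℕ) → Tor (fine (L ^ k) M) → Fin d → ℂ)} {C θ α : ℝ} (hC : 0 ≤ C) (hθ0 : 0 ≤ θ) (hθ1 : θ < 1) (hα : 0 ≤ α)
    (hNE3 : LocalRate (towReadings L M 𝒟) C θ) (hRc𝒟 : Rc ∈ 𝒟)
    (hRc1 : ∀ k x μ, ‖Rc k x μ‖ = 1) (hsize : ∀ k x μ, ‖((L ^ k : ℕ) : ℂ) * (Rc k x μ - 1)‖ ≤ α)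
    (hUBk : ∀ k (μ : Tor M → ℂ), ∃ f, Qk (L ^ k) M (nestOf L M k (Rc k)) f = μ ∧
      Sc (L ^ k) M (Rc k) f ≤ lamC d ((((L ^ k : ℕ)) : ℝ) * w' k) * nsq μ)
    (hPk : ∀ k f, qW (L ^ k) M f ≤ (1088 * (d : ℝ) + 128) * (Sc (L ^ k) M (Rc k) f + nsq (Qk (L ^ k) M (nestOf L M k (Rc k)) f)))
    (hG : ∀ k x, ‖G k x‖ = 1) (hc : ∀ k z, ‖c k z‖ ≤ 1)
    (hframe : ∀ k x μ, ‖G k (x + unitVec (fine (L ^ k) M) μ) - G k x * coarseT L (fine (L ^ k) M) (fineOf L M Rc k) x μ‖ ≤ mG k)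
    (hblock : ∀ k z j, ‖G k (bpt (L ^ k) M z j)
      - c k z * nestOf L M k (coarseT L (fine (L ^ k) M) (fineOf L M Rc k)) (bpt (L ^ k) M z j)‖ ≤ mB k)
    (hsmall : ∀ k, 16 * (d : ℝ) ^ 2 * ((((L ^ k : ℕ)) : ℝ) * mG k) ^ 2 + 4 * mB k ^ 2 ≤ 1 / 2)
    (hG' : ∀ k x, ‖G' k x‖ = 1) (hc' : ∀ k y, ‖c' k y‖ ≤ 1)
    (hframe' : ∀ k x μ, ‖G' k (x + unitVec (fine L (fine (L ^ k) M)) μ) - G' k x * fineOf L M Rc k x μ‖ ≤ mG' k)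
    (hblock' : ∀ k y j, ‖G' k (bpt L (fine (L ^ k) M) y j)
      - c' k y * taxiT L (fine (L ^ k) M) (fineOf L M Rc k) (bpt L (fine (L ^ k) M) y j)‖ ≤ mB' k)
    (hsmall' : ∀ k, 16 * (d : ℝ) ^ 2 * ((L : ℝ) * mG' k) ^ 2 + 4 * mB' k ^ 2 ≤ 1 / 2)
    (hm : ∀ k, 0 ≤ m k)
    (hmis : ∀ k y μ j, ‖mis L (fine (L ^ k) M) (coarseT L (fine (L ^ k) M) (fineOf L M Rc k)) (fineOf L M Rc k)
      (taxiT L (fine (L ^ k) M) (fineOf L M Rc k)) y μ j‖ ≤ m k)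
    (habsorb : ∀ k, 512 * (d : ℝ) ^ 2 * ((((L ^ k : ℕ)) : ℝ) * m k) ^ 2 ≤ 1 / 2)
    (hTb₀ : ∀ k x, ‖Tb₀ k x‖ = 1) (hw : ∀ k, 0 ≤ w k)
    (hwin : ∀ k (y : Tor M) (j : Fin d → Fin (L ^ k)) (μ : Fin d), (j μ : ℕ) + 1 < L ^ k →
      ‖coarseT L (fine (L ^ k) M) (fineOf L M Rc k) (bpt (L ^ k) M y j) μ
          * (starRingEnd ℂ) (Tb₀ k (bpt (L ^ k) M y j + unitVec (fine (L ^ k) M) μ)) * Tb₀ k (bpt (L ^ k) M y j) - 1‖ ≤ w k)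
    {γ : ℝ} (hγ : γ < 1)
    (hrel : ∀ k x, ‖nestOf L M k (coarseT L (fine (L ^ k) M) (fineOf L M Rc k)) x * (starRingEnd ℂ) (Tb₀ k x) - 1‖ ≤ γ)
    (hw'0 : ∀ k, 0 ≤ w' k) (hw' : ∀ k, (4 + (((L ^ k : ℕ)) : ℝ) * w k) / (1 - γ) - 1 ≤ (((L ^ k : ℕ)) : ℝ) * w' k)
    (ha : ∀ k, 0 ≤ a k)
    (hP : ∀ k x μ ν, ‖coarseT L (fine (L ^ k) M) (fineOf L M Rc k) x μ
        * coarseT L (fine (L ^ k) M) (fineOf L M Rc k) (x + unitVec (fine (L ^ k) M) μ) ν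
      - coarseT L (fine (L ^ k) M) (fineOf L M Rc k) x ν
        * coarseT L (fine (L ^ k) M) (fineOf L M Rc k) (x + unitVec (fine (L ^ k) M) ν) μ‖ ≤ a k)
    (hm₁ : ∀ k, 0 ≤ m₁ k)
    (hin : ∀ k (y : Tor (fine (L ^ k) M)) (j : Fin d → Fin L) (μ : Fin d), (j μ : ℕ) + 1 < L →
      ‖fineOf L M Rc k (bpt L (fine (L ^ k) M) y j) μ
          * (starRingEnd ℂ) (taxiT L (fine (L ^ k) M) (fineOf L M Rc k) (bpt L (fine (L ^ k) M) y j + unitVec (fine L (fine (L ^ k) M)) μ))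
          * taxiT L (fine (L ^ k) M) (fineOf L M Rc k) (bpt L (fine (L ^ k) M) y j) - 1‖ ≤ m₁ k)
    (hcross : ∀ k (y : Tor (fine (L ^ k) M)) (j : Fin d → Fin L) (μ : Fin d), (j μ : ℕ) + 1 = L →
      ‖fineOf L M Rc k (bpt L (fine (L ^ k) M) y j) μ
          * (starRingEnd ℂ) (taxiT L (fine (L ^ k) M) (fineOf L M Rc k) (bpt L (fine (L ^ k) M) y j + unitVec (fine L (fine (L ^ k) M)) μ))
          * taxiT L (fine (L ^ k) M) (fineOf L M Rc k) (bpt L (fine (L ^ k) M) y j)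
        - coarseT L (fine (L ^ k) M) (fineOf L M Rc k) y μ‖ ≤ m₁ k)
    {cw ca cm c₁ : ℝ}
    (hwc : ∀ k, (((L ^ k : ℕ)) : ℝ) * w' k ≤ cw) (hac : ∀ k, a k * (((L ^ k : ℕ)) : ℝ) ^ 2 ≤ ca)
    (hmc : ∀ k, (((L ^ k : ℕ)) : ℝ) ^ 2 * m k ≤ cm) (hm₁c : ∀ k, (((L ^ k : ℕ)) : ℝ) ^ 2 * m₁ k ≤ c₁)
    {a₀ : ℝ} (ha₀ : 0 < a₀) :
    TowerLimitRate (ι := fun _ => Tor M) (fun _ => (1 : Matrix (Tor M) (Tor M) ℂ)) 1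
      (fun k => effSc (L ^ k) M (Rc k) (nestOf L M k (Rc k)) a₀) (cTwoRuns d L cw ca cm c₁ (cRho C α) ((d : ℝ) * cRho C α))
      (max θ (L : ℝ)⁻¹) :=
  towerLimitRate_twoRuns_of_localRate L M Rc (fun k => coarseT L (fine (L ^ k) M) (fineOf L M Rc k)) (fun k => nestOf L M k (Rc k))
    (fun k => nestOf L M k (coarseT L (fine (L ^ k) M) (fineOf L M Rc k))) Tb₀ (fun k => fineOf L M Rc k)
    (fun k => taxiT L (fine (L ^ k) M) (fineOf L M Rc k)) G c mG mB G' c' mG' mB' m w w' a m₁ hL hC hθ0 hθ1 hα hNE3 hRc𝒟 hRc1 hsize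
    (fun _ => rfl) (fun _ => rfl) (fun _ => rfl) (fun _ => rfl) (fun _ => rfl) hUBk hPk hG hc hframe hblock hsmall hG' hc' hframe' hblock'
    hsmall' hm hmis habsorb hTb₀ hw hwin hγ hrel hw'0 hw' ha hP hm₁ hin hcross hwc hac hmc hm₁c ha₀

end End

end Summit.QuantumFields.BalabanUV.T4Continuum.VariationalCovariantTwoRunsSocket

end
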